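import Summits.BirchSwinnertonDyer.Rank1Residual.Additive.TwistPartnerForcedReduction
import Summits.BirchSwinnertonDyer.Rank1Residual.Additive.TameBranchOfSemistableTwist
import HarnessLib

/-!
# The forced twist partner ON DEFECT 2 is the `p`-stabilised symbol of the twist curve — so the
# boundedness criterion of `TwistPartnerForcedReduction.lean` is MET there, with THE unit root
# (cell `b2b-bsdres`, sub-cell additive-p2 = X3♯(G-ord) / X4♯(G-ord), gen 23; consistency check of
# the reduction against cc-typer-2's defect-2 producers `TameBranchOfSemistableTwist.lean`)

HONEST FRAMING (cell `b2b-bsdres`, run/shared/lean/b2b/bsd-rank1-residual/, verbatim in every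
file): the goal of the cell is to DELETE the COMBINATION-SHAPED residual classes of the
Birch–Swinnerton-Dyer formula for ALL analytic-rank `≤ 1` elliptic curves over `ℚ` — "full BSD
formula for every rank `≤ 1` curve in class `C`" assembled STRICTLY from published theorems — so
that the rank-`≤ 1` remainder becomes exactly the CONSTRUCTION-SHAPED classes, which are TYPED
(missing-input `Prop`s), NOT attempted. This is not "finishing BSD". Sub-cell additive-p2: the
classes X3♯(G-ord) / X4♯(G-ord) are CONSTRUCTION-SHAPED and stay so; labels / RESIDUAL-MAP marks
UNCHANGED; nothing is booked. THEOREMS ONLY (no definition, no named fact, no conjecture node).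

## What

`TwistPartnerForcedReduction.lean` reduced cc-typer-2's typed input `CensusX43.HasOrdinaryTwistPartner χ f`
to `U_p[·]⁺_f = 0 ∧ ∃ ã unit, forced χ [·]⁺_f ã bounded`, the forced partner being an explicit
function of `f`'s own symbols. On DEFECT 2 the input is a THEOREM (cc-typer-2,
`hasOrdinaryTwistPartner_legendre_of_goodOrd` / `…_of_mult`: the `p`-stabilised symbol
`Φ = c[·]⁺_g − α⁻¹c[p·]⁺_g` of the twist curve `E♭` with newform `g`, resp. `Φ = c[·]⁺_g` on (M)).
This file identifies the two: by uniqueness (`TwistPartner.eq_forced_of_partner`)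

* §1 `forced_legendre_eq_stabilisedSymbol_of_goodOrd` — on (G-ord, `e = 2`), even branch
  (`LegendreTwistPlusRel p f g c`, `V = E♭` good ordinary at `p` with newform `g`):
  `forced χ_p [·]⁺_f (unitRoot V p) = stabilisedSymbol (c·[·]⁺_g) (unitRoot V p) 1`, Mazur–Tate–
  Teitelbaum's `p`-stabilisation of `c·[·]⁺_g`; hence `exists_bound_forced_legendre_of_goodOrd`: the
  forced partner for THE unit root `α = unitRoot E♭ p` is BOUNDED (it is `c'·ℤ_p`-valued) — the
  criterion of the reduction holds on defect 2 with the unit named, and (by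
  `CensusX43.eigenvalue_unique_of_ratPlusSymbol_zero_ne_zero`) with no other unit on `[0]⁺_f ≠ 0` rows;
* §2 `forced_legendre_eq_of_mult`, `exists_bound_forced_legendre_of_mult` — the (M) twins
  (`p ∣ N'`, `a_p(g) = ±1`, no stabilisation: `forced χ_p [·]⁺_f (a_p(g)) = c·[·]⁺_g`).

So the dictionary of gen 22 and the forced partner of gen 23 are ONE object on defect 2 (the
measure of `exists_isTameBranchOf_of_bounded_forced` is the `χ_p`-twisted MTT measure of `E♭` up to
`c`), and on defect 3,4,6 — where no twist curve exists — the SAME explicit function of `E`'s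
symbols carries the one remaining input (boundedness; in print Manin–Drinfeld for Delbourgo's `f̃`).

References: B. Mazur, J. Tate, J. Teitelbaum, Invent. Math. 84 (1986) §I.8, §I.10 (10.1)–(10.2)
[MazurTateTeitelbaum1986Invent]; D. Delbourgo, Compositio Math. 113 (1998) §1.5, hypothesis (M)
p. 133 [Delbourgo1998]; G. Shimura, *Introduction to the arithmetic theory of automorphic
functions* (1971) Prop. 3.64 [Shimura1971].
-/

noncomputable section

open scoped Classical MatrixGroups ModularForm

open CongruenceSubgroup

namespace Summit.BirchSwinnertonDyer.Rank1Residual.Additive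

open Literature.NumberTheory.EllipticCurves Literature.NumberTheory.EllipticCurves.ModularForms
  Literature.NumberTheory.EllipticCurves.Rank1Residual

/-! ### §1 (G-ord, `e = 2`): the forced partner is the `p`-stabilised symbol of `c·[·]⁺_{f♭}` -/

section GoodOrdinary

variable {p : ℕ} [hp : Fact p.Prime] {N N' : ℕ} [NeZero N] [NeZero N'] {f : CuspForm (Gamma0 N) 2}
  {g : CuspForm (Gamma0 N') 2} (V : WeierstrassCurve ℚ) [V.IsElliptic] [V.IsGloballyMinimal]

/-- **On (G-ord, `e = 2`) the forced partner IS the `p`-stabilised twist-curve symbol.** Let `V`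
(= `E♭`) be good ORDINARY at the odd prime `p` with newform `g`, and let `f` satisfy cc-typer-2's
Legendre twist relation `[s]⁺_f = c∑_u (u/p)[s + u/p]⁺_g` (`LegendreTwistPlusRel p f g c`; PROVED for
`f = f_E`, `E ≅ V ⊗ χ_p`, `p ≡ 1 (mod 4)`, by `exists_legendreTwistPlusRel_of_twist`). Then
`forced χ_p [·]⁺_f (unitRoot V p) = stabilisedSymbol (c·[·]⁺_g) (unitRoot V p) 1`
(`= c[·]⁺_g − α⁻¹c[p·]⁺_g`): the stabilised symbol is a partner with eigenvalue `α = unitRoot V p`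
(cc-typer-2: `stabilisedSymbol_add_one`, `twist_stabilisedSymbol`, `sum_stabilisedSymbol_eq` from the
`T_p`-relation `intCast_mul_ratPlusSymbol`), and partners are unique (`TwistPartner.eq_forced_of_partner`).
[cite: MazurTateTeitelbaum1986Invent, §I.10 (10.1)–(10.2)] [cite: Shimura1971, Prop. 3.64] -/
theorem forced_legendre_eq_stabilisedSymbol_of_goodOrd (hp2 : p ≠ 2) (hord : IsOrdinaryAt V p)
    (hg : IsNewformOf V g) {c : ℚ} (hrel : LegendreTwistPlusRel p f g c) :
    TwistPartner.forced (legendreChar p) (fun r ↦ ((ratPlusSymbol f r : ℚ) : ℚ_[p]))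
        (unitRoot V p : ℚ_[p]) =
      stabilisedSymbol (fun r ↦ (c : ℚ_[p]) * ((ratPlusSymbol g r : ℚ) : ℚ_[p]))
        (unitRoot V p : ℚ_[p]) 1 := by
  haveI : NeZero p := ⟨hp.out.ne_zero⟩
  have hMD := exists_nsmul_modularSymbol_mem_periodLattice_of_isNewformOf hg
  have hrat := ratCast_ratPlusSymbol_of_maninDrinfeld hMD
  obtain ⟨hαeq, hαu, -⟩ := unitRoot_coe_spec (W := V) hord
  have hα0 : (unitRoot V p : ℚ_[p]) ≠ 0 := fun h ↦ by
    rw [h, norm_zero] at hαu; exact zero_ne_one hαu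
  have hpN : ¬ p ∣ N' := not_dvd_level_of_isNewformOf hg hord.1
  have hap := cuspCoeff_eq_frobeniusTrace_of_isNewformOf_holds hg hord.1
  have hχ : legendreChar p ≠ 1 := legendreChar_ne_one p hp2
  have hχi : (legendreChar p)⁻¹ ≠ 1 := fun h1 ↦ hχ (inv_eq_one.mp h1)
  set S : ℚ → ℚ_[p] := fun r ↦ (c : ℚ_[p]) * ((ratPlusSymbol g r : ℚ) : ℚ_[p]) with hSdef
  -- periodicity of `S` and of `[·]⁺_f`
  have hperS : ∀ s, S (s + 1) = S s := fun s ↦ by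
    simp only [hSdef]
    rw [show (s + 1 : ℚ) = s + ((1 : ℤ) : ℚ) by push_cast; rfl, ratPlusSymbol_add_intCast_eq]
  have hperx : ∀ s, (fun r ↦ ((ratPlusSymbol f r : ℚ) : ℚ_[p])) (s + 1) =
      (fun r ↦ ((ratPlusSymbol f r : ℚ) : ℚ_[p])) s := fun s ↦ by
    simp only
    rw [show (s + 1 : ℚ) = s + ((1 : ℤ) : ℚ) by push_cast; rfl, ratPlusSymbol_add_intCast_eq]
  -- the `T_p` Hecke relation for `S`
  have hH : ∀ r : ℚ, ((V.frobeniusTrace p : ℤ) : ℚ_[p]) * S r =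
      ∑ j : Fin p, S ((r + ((j : ℕ) : ℚ)) / p) + 1 * S (p * r) := by
    intro r
    have h := intCast_mul_ratPlusSymbol p hg.1 hp.out hpN hap hrat r
    have h' := congrArg (fun q : ℚ ↦ (c : ℚ_[p]) * (q : ℚ_[p])) h
    push_cast at h'
    rw [mul_add, Finset.mul_sum] at h'
    simp only [hSdef]
    linear_combination h'
  have hαpoly : (unitRoot V p : ℚ_[p]) ^ 2 - ((V.frobeniusTrace p : ℤ) : ℚ_[p]) * (unitRoot V p : ℚ_[p])
      + 1 * p = 0 := by
    rw [one_mul]; exact hαeq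
  -- the stabilised symbol is a partner with eigenvalue `α`
  have hper := stabilisedSymbol_add_one (α := (unitRoot V p : ℚ_[p])) (δ := (1 : ℚ_[p])) hperS
  have hx : ∀ s, (fun r ↦ ((ratPlusSymbol f r : ℚ) : ℚ_[p])) s =
      CensusX43.twist (legendreChar p)⁻¹
        (stabilisedSymbol S (unitRoot V p : ℚ_[p]) 1) s := fun s ↦ by
    simp only
    rw [hrel.cast_eq_twist, twist_stabilisedSymbol hperS hχi]
  have hU := sum_stabilisedSymbol_eq hperS hH hαpoly hα0
  exact (TwistPartner.eq_forced_of_partner hχ hαu hperx hper hx hU).symm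

/-- **Hence on (G-ord, `e = 2`) the boundedness criterion is MET with THE unit root**: under the same
hypotheses the forced partner for `α = unitRoot V p` is bounded (the stabilised symbol of a
`c'·ℤ_p`-valued symbol is `c'·ℤ_p`-valued: Manin–Drinfeld for `g`, `exists_stabilisedSymbol_eq_mul`).
So `hasOrdinaryTwistPartner_iff_of_addv` is sharp on defect 2, and by
`CensusX43.eigenvalue_unique_of_ratPlusSymbol_zero_ne_zero` no other unit works on `[0]⁺_f ≠ 0` rows.
[cite: MazurTateTeitelbaum1986Invent, §I.10 (10.1)] -/
theorem exists_bound_forced_legendre_of_goodOrd (hp2 : p ≠ 2) (hord : IsOrdinaryAt V p)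
    (hg : IsNewformOf V g) {c : ℚ} (hrel : LegendreTwistPlusRel p f g c) :
    ∃ C : ℝ, ∀ s, ‖TwistPartner.forced (legendreChar p) (fun r ↦ ((ratPlusSymbol f r : ℚ) : ℚ_[p]))
      (unitRoot V p : ℚ_[p]) s‖ ≤ C := by
  haveI : NeZero p := ⟨hp.out.ne_zero⟩
  have hMD := exists_nsmul_modularSymbol_mem_periodLattice_of_isNewformOf hg
  obtain ⟨D, hD, hden⟩ := exists_forall_ratPlusSymbol_eq_div_of_maninDrinfeld hMD
  obtain ⟨c', hlat⟩ := exists_forall_eq_mul_padicInt_of_eq_div (p := p) hD hden c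
  obtain ⟨-, hαu, -⟩ := unitRoot_coe_spec (W := V) hord
  rw [forced_legendre_eq_stabilisedSymbol_of_goodOrd V hp2 hord hg hrel]
  refine ⟨‖c'‖, fun s ↦ ?_⟩
  obtain ⟨z, hz⟩ := exists_stabilisedSymbol_eq_mul (δ := (1 : ℚ_[p])) hαu (by rw [norm_one]) hlat s
  rw [hz, norm_mul]
  exact mul_le_of_le_one_right (norm_nonneg _) z.norm_le_one

end GoodOrdinary

/-! ### §2 (M): the forced partner is `c·[·]⁺_{f♭}` itself -/

section Multiplicative

variable {p : ℕ} [hp : Fact p.Prime] {N N' : ℕ} [NeZero N] [NeZero N'] {f : CuspForm (Gamma0 N) 2}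
  {g : CuspForm (Gamma0 N') 2}

/-- **On (M) the forced partner IS `c·[·]⁺_g`** (`g` the newform of the MULTIPLICATIVE twist `E♭`,
`p ∣ N'`, `a_p(g) = ±1`, no stabilisation: `U_p g = a_p g`, `intCast_mul_ratPlusSymbol_of_dvd`;
`LegendreTwistPlusRel p f g c`): `forced χ_p [·]⁺_f (a_p(g)) = c·[·]⁺_g`.
[cite: MazurTateTeitelbaum1986Invent, §I.4 and §I.10 (10.1) with ε(p) = 0]
[cite: Delbourgo1998, hypothesis (M) (p. 133)] -/
theorem forced_legendre_eq_of_mult (hp2 : p ≠ 2) (hg : IsNewform0 g) (hQ : coeffField g = ⊥)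
    (hpN : p ∣ N') {ap : ℤ} (hap : cuspCoeff g p = ap) (hap1 : ap = 1 ∨ ap = -1) {c : ℚ}
    (hrel : LegendreTwistPlusRel p f g c) :
    TwistPartner.forced (legendreChar p) (fun r ↦ ((ratPlusSymbol f r : ℚ) : ℚ_[p]))
        ((ap : ℤ) : ℚ_[p]) =
      fun r ↦ (c : ℚ_[p]) * ((ratPlusSymbol g r : ℚ) : ℚ_[p]) := by
  haveI : NeZero p := ⟨hp.out.ne_zero⟩
  have hMD := exists_nsmul_modularSymbol_mem_periodLattice_of_isNewform0 hg hQ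
  have hrat := ratCast_ratPlusSymbol_of_maninDrinfeld hMD
  have hαu : ‖((ap : ℤ) : ℚ_[p])‖ = 1 := by
    rcases hap1 with h | h <;> simp [h]
  have hα0 : ((ap : ℤ) : ℚ_[p]) ≠ 0 := fun h ↦ by rw [h, norm_zero] at hαu; exact zero_ne_one hαu
  have hχ : legendreChar p ≠ 1 := legendreChar_ne_one p hp2
  have hχi : (legendreChar p)⁻¹ ≠ 1 := fun h1 ↦ hχ (inv_eq_one.mp h1)
  set S : ℚ → ℚ_[p] := fun r ↦ (c : ℚ_[p]) * ((ratPlusSymbol g r : ℚ) : ℚ_[p]) with hSdef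
  have hperS : ∀ s, S (s + 1) = S s := fun s ↦ by
    simp only [hSdef]
    rw [show (s + 1 : ℚ) = s + ((1 : ℤ) : ℚ) by push_cast; rfl, ratPlusSymbol_add_intCast_eq]
  have hperx : ∀ s, (fun r ↦ ((ratPlusSymbol f r : ℚ) : ℚ_[p])) (s + 1) =
      (fun r ↦ ((ratPlusSymbol f r : ℚ) : ℚ_[p])) s := fun s ↦ by
    simp only
    rw [show (s + 1 : ℚ) = s + ((1 : ℤ) : ℚ) by push_cast; rfl, ratPlusSymbol_add_intCast_eq]
  -- the `U_p` Hecke relation for `S` (`δ = 0`)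
  have hH : ∀ r : ℚ, ((ap : ℤ) : ℚ_[p]) * S r =
      ∑ j : Fin p, S ((r + ((j : ℕ) : ℚ)) / p) + 0 * S (p * r) := by
    intro r
    have h := intCast_mul_ratPlusSymbol_of_dvd p hg hp.out hpN hap hrat r
    have h' := congrArg (fun q : ℚ ↦ (c : ℚ_[p]) * (q : ℚ_[p])) h
    push_cast at h'
    rw [Finset.mul_sum] at h'
    simp only [hSdef]
    linear_combination h'
  have hαpoly : ((ap : ℤ) : ℚ_[p]) ^ 2 - ((ap : ℤ) : ℚ_[p]) * ((ap : ℤ) : ℚ_[p]) + 0 * p = 0 := by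
    ring
  have hper := stabilisedSymbol_add_one (α := ((ap : ℤ) : ℚ_[p])) (δ := (0 : ℚ_[p])) hperS
  have hx : ∀ s, (fun r ↦ ((ratPlusSymbol f r : ℚ) : ℚ_[p])) s =
      CensusX43.twist (legendreChar p)⁻¹ (stabilisedSymbol S ((ap : ℤ) : ℚ_[p]) 0) s := fun s ↦ by
    simp only
    rw [hrel.cast_eq_twist, twist_stabilisedSymbol hperS hχi]
  have hU := sum_stabilisedSymbol_eq hperS hH hαpoly hα0
  have h := (TwistPartner.eq_forced_of_partner hχ hαu hperx hper hx hU).symm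
  rw [h]
  funext r
  rw [stabilisedSymbol_apply, mul_zero, zero_mul, sub_zero]

/-- **Hence on (M) the boundedness criterion is MET with `α = a_p(E♭)`**: the forced partner is
`c'·ℤ_p`-valued, hence bounded. [cite: MazurTateTeitelbaum1986Invent, §I.10 (10.1)] -/
theorem exists_bound_forced_legendre_of_mult (hp2 : p ≠ 2) (hg : IsNewform0 g)
    (hQ : coeffField g = ⊥) (hpN : p ∣ N') {ap : ℤ} (hap : cuspCoeff g p = ap)
    (hap1 : ap = 1 ∨ ap = -1) {c : ℚ} (hrel : LegendreTwistPlusRel p f g c) :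
    ∃ C : ℝ, ∀ s, ‖TwistPartner.forced (legendreChar p) (fun r ↦ ((ratPlusSymbol f r : ℚ) : ℚ_[p]))
      ((ap : ℤ) : ℚ_[p]) s‖ ≤ C := by
  haveI : NeZero p := ⟨hp.out.ne_zero⟩
  have hMD := exists_nsmul_modularSymbol_mem_periodLattice_of_isNewform0 hg hQ
  obtain ⟨D, hD, hden⟩ := exists_forall_ratPlusSymbol_eq_div_of_maninDrinfeld hMD
  obtain ⟨c', hlat⟩ := exists_forall_eq_mul_padicInt_of_eq_div (p := p) hD hden c
  rw [forced_legendre_eq_of_mult hp2 hg hQ hpN hap hap1 hrel]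
  refine ⟨‖c'‖, fun s ↦ ?_⟩
  obtain ⟨z, hz⟩ := hlat s
  simp only
  rw [hz, norm_mul]
  exact mul_le_of_le_one_right (norm_nonneg _) z.norm_le_one

end Multiplicative

end Summit.BirchSwinnertonDyer.Rank1Residual.Additive

end
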